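import Literature.Topology.FourManifolds.GaussDiagramsStability
import Literature.Topology.FourManifolds.GaussDiagramsReadUnique
import Literature.Topology.FourManifolds.GaussDiagramsRMoves
import Literature.Topology.FourManifolds.ClosedBallProofs
import HarnessLib

/-!
# Along an ambient isotopy the Gauss diagram of a regular knot is locally constant

Topic `Literature/Topology/FourManifolds`; the knot-level form of the stability brick
`GaussDiagramsStability.lean` of the direction `→` of Reidemeister's theorem in Gauss-diagram form
(the named fact `Knot.reidemeisterR` of `RasmussenWellDefinedR.lean`; on projections
`stub_reidemeisterR`). For a knot `K`, an ambient isotopy `F` of `𝕊³` along which the knot never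
meets the north pole (the general case reduces to this one, `GaussDiagramsPoleAvoidance.lean`),
and the moved knots `K.along F t = F_t ∘ K`:

* `Knot.RegularProjection.eventually_exists_along`, `…_of_mem` — **regular position and the Gauss
  diagram persist**: if `K.along F t₀` has a regular projection reading `G`, then so does
  `K.along F t` for all `t` near `t₀`, with the SAME based, labelled diagram `G`
  (`IsRegularReading.eventually_exists` applied to the chart track
  `(t, θ) ↦ stereoNorthCoords (F_t (K (cos θ, sin θ)))`, jointly `C^∞` off the pole; the base time is
  moved by the re-based isotopy `AmbientIsotopy.shift`);
* `Knot.isOpen_setOf_hasGaussDiagram_along` — the set of times at which the moved knot has Gauss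
  diagram `G` is open;
* `Knot.RegularProjection.equiv_diagram_along_of_isPreconnected` (and `rEquiv_…`) — **no
  Reidemeister move happens while the projection stays regular**: if the moved knot is in regular
  position at every time of a preconnected set `S` of times (e.g. an interval), then the diagrams
  read at any two times of `S`, on any regular projections, are related by relabellings only
  (`GaussDiagram.Equiv`, indeed chains of `PolyakMove.relabel`; reading uniqueness
  `GaussDiagramsReadUnique.lean` compares two projections at one time, and an open equivalence
  relation on a preconnected set has one class, `IsPreconnected.induction₂`).

Everything here is proved; no named facts are introduced.

## References

* K. Reidemeister, *Knotentheorie* (1932), Kap. I §1 (a deformation keeping the projection regular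
  does not change the diagram). [cite: Reidemeister1932, Kap. I §1]
* V. Guillemin, A. Pollack, *Differential Topology* (1974), Ch. 1 §6 (stability).
  [GuilleminPollack2010]
* M. W. Hirsch, *Differential Topology*, GTM 33 (1976), Ch. 8 §1 (ambient isotopies). [HirschDT1976]
-/

open scoped Manifold ContDiff Topology
open Function Set Filter

noncomputable section

namespace Literature.Topology.FourManifolds

/-! ### Re-basing an ambient isotopy at a time `t₀` -/

namespace AmbientIsotopy

variable {EN HN : Type*} [NormedAddCommGroup EN] [NormedSpace ℝ EN] [TopologicalSpace HN]
  {J : ModelWithCorners ℝ EN HN} {N : Type*} [TopologicalSpace N] [ChartedSpace HN N]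

/-- The **re-based ambient isotopy** `s ↦ F (t₀ + s) ∘ (F t₀)⁻¹` of an ambient isotopy `F`: it
starts at `id` and carries the stage `t₀` of `F` to its stage `t₀ + s`. Each stage is the
diffeomorphism `(F.toDiffeomorph t₀).symm.trans (F.toDiffeomorph (t₀ + s))`; joint smoothness is
that of `uncurry F` composed with the smooth map `(s, x) ↦ (t₀ + s, (F t₀)⁻¹ x)` (compare
`AmbientIsotopy.reverse`). Hirsch (1976), Ch. 8 §1, p. 178. [cite: HirschDT1976, Ch. 8 §1, p. 178] -/
def shift (F : AmbientIsotopy J N) (t₀ : ℝ) : AmbientIsotopy J N where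
  toFun s := ⇑((F.toDiffeomorph t₀).symm.trans (F.toDiffeomorph (t₀ + s)))
  contMDiff := by
    have h : ContMDiff (𝓘(ℝ, ℝ).prod J) (𝓘(ℝ, ℝ).prod J) ∞
        (fun p : ℝ × N ↦ (t₀ + p.1, (F.toDiffeomorph t₀).symm p.2)) :=
      ((contDiff_const.add contDiff_id).contMDiff.comp contMDiff_fst).prodMk
        ((F.toDiffeomorph t₀).symm.contMDiff.comp contMDiff_snd)
    exact F.contMDiff.comp h
  bijective s := ((F.toDiffeomorph t₀).symm.trans (F.toDiffeomorph (t₀ + s))).bijective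
  isLocalDiffeomorph s :=
    ((F.toDiffeomorph t₀).symm.trans (F.toDiffeomorph (t₀ + s))).isLocalDiffeomorph
  map_zero := by
    funext x
    rw [add_zero, Diffeomorph.coe_trans, Function.comp_apply, Diffeomorph.apply_symm_apply, id]

/-- Stages of the re-based ambient isotopy. [folklore] -/
@[simp]
theorem shift_toFun (F : AmbientIsotopy J N) (t₀ s : ℝ) :
    (F.shift t₀).toFun s = F.toFun (t₀ + s) ∘ ⇑(F.toDiffeomorph t₀).symm := rfl

/-- The re-based isotopy carries `F t₀ x` to `F (t₀ + s) x`. [folklore] -/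
theorem shift_toFun_apply (F : AmbientIsotopy J N) (t₀ s : ℝ) (x : N) :
    (F.shift t₀).toFun s (F.toFun t₀ x) = F.toFun (t₀ + s) x := by
  rw [shift_toFun, Function.comp_apply, ← F.coe_toDiffeomorph t₀, Diffeomorph.symm_apply_apply]

end AmbientIsotopy

/-! ### The moved knots and their chart track -/

namespace Knot

variable (K : Knot) (F : AmbientIsotopy (𝓡 3) (Metric.sphere (0 : EuclideanSpace ℝ (Fin 4)) 1))

/-- **The knot moved by stage `t` of an ambient isotopy**: `K.along F t = F_t ∘ K` (the same
structure as `SphereEmbedding.map K (F.toDiffeomorph t)` of `GluckTwistTransport.lean`, which is not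
imported here). Rolfsen (1976), §1.A. [folklore] -/
def along (t : ℝ) : Knot :=
  ⟨F.toFun t ∘ K, K.isSmoothEmbedding.diffeomorph_comp (F.toDiffeomorph t)⟩

/-- The moved knot evaluated at a point. [folklore] -/
@[simp] theorem along_apply (t : ℝ) (x : Metric.sphere (0 : EuclideanSpace ℝ (Fin 2)) 1) :
    K.along F t x = F.toFun t (K x) := rfl

/-- At time `0` the knot has not moved. [folklore] -/
theorem along_zero : K.along F 0 = K := by
  apply SphereEmbedding.ext
  funext x
  change F.toFun 0 (K x) = K x
  rw [F.map_zero]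
  rfl

/-- Moving by the re-based isotopy from time `t₀` is moving by `F` from time `0`. [folklore] -/
theorem along_shift (t₀ s : ℝ) : (K.along F t₀).along (F.shift t₀) s = K.along F (t₀ + s) := by
  apply SphereEmbedding.ext
  funext x
  exact F.shift_toFun_apply t₀ s (K x)

/-- **The track of the knot in `ℝ⁴` is jointly smooth in `(t, θ)`.** [folklore] -/
theorem contDiff_track :
    ContDiff ℝ ∞ fun p : ℝ × ℝ ↦
      ((F.toFun p.1 (K (circlePoint p.2)) : Metric.sphere (0 : EuclideanSpace ℝ (Fin 4)) 1) :
        EuclideanSpace ℝ (Fin 4)) := by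
  haveI : Fact (Module.finrank ℝ (EuclideanSpace ℝ (Fin (3 + 1))) = 3 + 1) :=
    fact_finrank_euclideanSpace_four
  have hK : ContMDiff 𝓘(ℝ, ℝ) (𝓡 3) ∞ fun θ ↦ K (circlePoint θ) :=
    K.contMDiff.comp contMDiff_circlePoint
  have hin : ContMDiff (𝓘(ℝ, ℝ).prod 𝓘(ℝ, ℝ)) (𝓘(ℝ, ℝ).prod (𝓡 3)) ∞
      fun p : ℝ × ℝ ↦ (p.1, K (circlePoint p.2)) :=
    contMDiff_fst.prodMk (hK.comp contMDiff_snd)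
  have hA : ContMDiff (𝓘(ℝ, ℝ).prod 𝓘(ℝ, ℝ)) 𝓘(ℝ, EuclideanSpace ℝ (Fin 4)) ∞
      fun p : ℝ × ℝ ↦ ((F.toFun p.1 (K (circlePoint p.2)) :
        Metric.sphere (0 : EuclideanSpace ℝ (Fin 4)) 1) : EuclideanSpace ℝ (Fin 4)) :=
    contMDiff_coe_sphere.comp (F.contMDiff.comp hin)
  rw [← modelWithCornersSelf_prod, chartedSpaceSelf_prod] at hA
  exact hA.contDiff

/-- **The chart track `(t, θ) ↦ stereoNorthCoords (F_t (K (cos θ, sin θ)))` is jointly smooth as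
long as the knot misses the north pole.** [folklore] -/
theorem contDiff_stereo_track
    (hF : ∀ t (x : Metric.sphere (0 : EuclideanSpace ℝ (Fin 2)) 1), F.toFun t (K x) ≠ northPole) :
    ContDiff ℝ ∞ fun p : ℝ × ℝ ↦ stereoNorthCoords
      ((F.toFun p.1 (K (circlePoint p.2)) : Metric.sphere (0 : EuclideanSpace ℝ (Fin 4)) 1) :
        EuclideanSpace ℝ (Fin 4)) := by
  rw [contDiff_iff_contDiffAt]
  intro p
  have h1 : ContDiffAt ℝ ∞ stereoNorthCoords
      (((F.toFun p.1 (K (circlePoint p.2)) : Metric.sphere (0 : EuclideanSpace ℝ (Fin 4)) 1) :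
        EuclideanSpace ℝ (Fin 4))) :=
    contDiffAt_stereoNorthCoords (apply_three_ne_one_of_ne_northPole (hF p.1 _))
  change ContDiffAt ℝ ∞ (stereoNorthCoords ∘ fun p : ℝ × ℝ ↦
    ((F.toFun p.1 (K (circlePoint p.2)) : Metric.sphere (0 : EuclideanSpace ℝ (Fin 4)) 1) :
      EuclideanSpace ℝ (Fin 4))) p
  exact h1.comp p (K.contDiff_track F).contDiffAt

/-- The plane curve of the moved knot, read on the chart track. [folklore] -/
theorem planeCurve_along (t θ : ℝ) :
    (K.along F t).planeCurve θ = (stereoNorthCoords ((F.toFun t (K (circlePoint θ)) :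
      Metric.sphere (0 : EuclideanSpace ℝ (Fin 4)) 1) : EuclideanSpace ℝ (Fin 4))).1 := rfl

/-- The height function of the moved knot, read on the chart track. [folklore] -/
theorem heightCurve_along (t θ : ℝ) :
    (K.along F t).heightCurve θ = (stereoNorthCoords ((F.toFun t (K (circlePoint θ)) :
      Metric.sphere (0 : EuclideanSpace ℝ (Fin 4)) 1) : EuclideanSpace ℝ (Fin 4))).2 := rfl

/-! ### Regular position and the diagram persist -/

namespace RegularProjection

variable {K}

/-- Transport of a regular projection along an equality of knots. [folklore] -/
theorem exists_diagram_eq_of_eq {K K' : Knot} (h : K = K') (P : K.RegularProjection) :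
    ∃ P' : K'.RegularProjection, P'.diagram = P.diagram := by
  subst h
  exact ⟨P, rfl⟩

variable (K) in
/-- **Regular position and the Gauss diagram persist along an ambient isotopy** (base time `0`):
if `K` has a regular projection reading `G` and the knot never meets the north pole along `F`,
then for all `t` near `0` the moved knot `K.along F t` has a regular projection reading the same
`G`. Reidemeister (1932), Kap. I §1; Guillemin–Pollack (1974), Ch. 1 §6.
[cite: Reidemeister1932, Kap. I §1] -/
theorem eventually_exists_along (P : K.RegularProjection)
    (hF : ∀ t (x : Metric.sphere (0 : EuclideanSpace ℝ (Fin 2)) 1), F.toFun t (K x) ≠ northPole) :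
    ∀ᶠ t in 𝓝 (0 : ℝ), ∃ Pt : (K.along F t).RegularProjection, Pt.diagram = P.diagram := by
  have hE := K.contDiff_stereo_track F hF
  set Γ : ℝ → ℝ → ℝ × ℝ := fun t θ ↦ (stereoNorthCoords ((F.toFun t (K (circlePoint θ)) :
    Metric.sphere (0 : EuclideanSpace ℝ (Fin 4)) 1) : EuclideanSpace ℝ (Fin 4))).1 with hΓ_def
  set H : ℝ → ℝ → ℝ := fun t θ ↦ (stereoNorthCoords ((F.toFun t (K (circlePoint θ)) :
    Metric.sphere (0 : EuclideanSpace ℝ (Fin 4)) 1) : EuclideanSpace ℝ (Fin 4))).2 with hH_def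
  have hΓ : ContDiff ℝ 1 (uncurry Γ) := (contDiff_fst.comp hE).of_le (by exact_mod_cast le_top)
  have hH : Continuous (uncurry H) := continuous_snd.comp hE.continuous
  have hper : ∀ t, Periodic (Γ t) (2 * Real.pi) := fun t θ ↦ by
    simp only [hΓ_def, circlePoint_add_two_pi]
  have e0Γ : Γ 0 = K.planeCurve := by
    funext θ
    simp only [hΓ_def, F.map_zero, id]
    rfl
  have e0H : H 0 = K.heightCurve := by
    funext θ
    simp only [hH_def, F.map_zero, id]
    rfl
  have h₀ : IsRegularReading (Γ 0) (H 0) P.diagram P.θ := by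
    rw [e0Γ, e0H]
    exact P.isRegularReading
  filter_upwards [h₀.eventually_exists hΓ hH hper] with t ht
  obtain ⟨θ, hθ⟩ := ht
  have hKt : northPole ∉ range (K.along F t) := by
    rintro ⟨x, hx⟩
    exact hF t x hx
  exact ⟨ofIsRegularReading hKt hθ, rfl⟩

variable (K) in
/-- **Regular position and the Gauss diagram persist along an ambient isotopy** (any base time):
if the moved knot `K.along F t₀` has a regular projection reading `G` and the knot never meets the
north pole along `F`, then for all `t` near `t₀` the moved knot `K.along F t` has a regular
projection reading the same `G`. [cite: Reidemeister1932, Kap. I §1] -/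
theorem eventually_exists_along_of_mem {t₀ : ℝ} (P : (K.along F t₀).RegularProjection)
    (hF : ∀ t (x : Metric.sphere (0 : EuclideanSpace ℝ (Fin 2)) 1), F.toFun t (K x) ≠ northPole) :
    ∀ᶠ t in 𝓝 t₀, ∃ Pt : (K.along F t).RegularProjection, Pt.diagram = P.diagram := by
  have hF' : ∀ s (x : Metric.sphere (0 : EuclideanSpace ℝ (Fin 2)) 1),
      (F.shift t₀).toFun s ((K.along F t₀) x) ≠ northPole := fun s x ↦ by
    rw [along_apply, F.shift_toFun_apply]
    exact hF _ _
  have h := eventually_exists_along (K.along F t₀) (F.shift t₀) P hF'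
  have ht : Tendsto (fun t : ℝ ↦ t - t₀) (𝓝 t₀) (𝓝 0) := by
    have h1 : Tendsto (fun t : ℝ ↦ t - t₀) (𝓝 t₀) (𝓝 (t₀ - t₀)) :=
      tendsto_id.sub tendsto_const_nhds
    rwa [sub_self] at h1
  filter_upwards [ht.eventually h] with t ht'
  obtain ⟨Ps, hPs⟩ := ht'
  have e : (K.along F t₀).along (F.shift t₀) (t - t₀) = K.along F t := by
    rw [along_shift, add_sub_cancel]
  obtain ⟨Pt, hPt⟩ := exists_diagram_eq_of_eq e Ps
  exact ⟨Pt, hPt.trans hPs⟩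

end RegularProjection

/-- **The set of times at which the moved knot has Gauss diagram `G` is open** (the knot never
meeting the pole along `F`). [cite: Reidemeister1932, Kap. I §1] -/
theorem isOpen_setOf_hasGaussDiagram_along
    (hF : ∀ t (x : Metric.sphere (0 : EuclideanSpace ℝ (Fin 2)) 1), F.toFun t (K x) ≠ northPole)
    (G : GaussDiagram) : IsOpen {t : ℝ | (K.along F t).HasGaussDiagram G} := by
  rw [isOpen_iff_mem_nhds]
  rintro t₀ ⟨P, rfl⟩
  filter_upwards [RegularProjection.eventually_exists_along_of_mem K F P hF] with t ht
  obtain ⟨Pt, hPt⟩ := ht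
  exact ⟨Pt, hPt⟩

/-- **The set of times at which the moved knot is in regular position (has some regular
projection) is open.** [cite: Reidemeister1932, Kap. I §1] -/
theorem isOpen_setOf_nonempty_regularProjection_along
    (hF : ∀ t (x : Metric.sphere (0 : EuclideanSpace ℝ (Fin 2)) 1), F.toFun t (K x) ≠ northPole) :
    IsOpen {t : ℝ | Nonempty ((K.along F t).RegularProjection)} := by
  rw [isOpen_iff_mem_nhds]
  rintro t₀ ⟨P⟩
  filter_upwards [RegularProjection.eventually_exists_along_of_mem K F P hF] with t ht
  obtain ⟨Pt, -⟩ := ht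
  exact ⟨Pt⟩

/-! ### No move while the projection stays regular -/

namespace RegularProjection

variable {K}

variable (K) in
/-- **No Reidemeister move happens while the projection stays regular.** Let the knot never meet
the north pole along `F`, and let `S` be a preconnected set of times (e.g. an interval) at each of
which the moved knot is in regular position. Then the Gauss diagrams read at any two times of `S`,
on any regular projections, are Polyak equivalent — indeed related by relabellings
`PolyakMove.relabel` only: locally the based, labelled diagram is constant
(`eventually_exists_along_of_mem`), two projections at one time read relabelled diagrams
(`isRelabelling_diagram`, `GaussDiagramsReadUnique.lean`), and an equivalence relation with open
classes on a preconnected set has one class. Reidemeister (1932), Kap. I §1.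
[cite: Reidemeister1932, Kap. I §1] -/
theorem equiv_diagram_along_of_isPreconnected
    (hF : ∀ t (x : Metric.sphere (0 : EuclideanSpace ℝ (Fin 2)) 1), F.toFun t (K x) ≠ northPole)
    {S : Set ℝ} (hS : IsPreconnected S) (hreg : ∀ t ∈ S, Nonempty ((K.along F t).RegularProjection))
    {a b : ℝ} (ha : a ∈ S) (hb : b ∈ S) (Pa : (K.along F a).RegularProjection)
    (Pb : (K.along F b).RegularProjection) : Pa.diagram.Equiv Pb.diagram := by
  have key := hS.induction₂ (fun x y ↦ ∀ (Px : (K.along F x).RegularProjection)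
      (Py : (K.along F y).RegularProjection), Px.diagram.Equiv Py.diagram) ?_ ?_ ?_ ha hb
  · exact key Pa Pb
  · intro x hx
    obtain ⟨Px₀⟩ := hreg x hx
    have h := eventually_exists_along_of_mem K F Px₀ hF
    refine (h.filter_mono nhdsWithin_le_nhds).mono fun y hy Px Py ↦ ?_
    obtain ⟨Py₀, hy₀⟩ := hy
    have h1 : Px.diagram.Equiv Px₀.diagram :=
      (GaussDiagram.PolyakMove.relabel _ _ (Px.isRelabelling_diagram Px₀)).equiv
    have h2 : Py₀.diagram.Equiv Py.diagram :=
      (GaussDiagram.PolyakMove.relabel _ _ (Py₀.isRelabelling_diagram Py)).equiv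
    rw [hy₀] at h2
    exact h1.trans h2
  · intro x y z _ hy _ hxy hyz Px Pz
    obtain ⟨Py⟩ := hreg y hy
    exact (hxy Px Py).trans (hyz Py Pz)
  · intro x y _ _ hxy Py Px
    exact (hxy Px Py).symm

variable (K) in
/-- The same with Reidemeister equivalence `REquiv` (implied by Polyak equivalence). In particular,
between two times of an interval of regular times no move of `RMove` other than relabellings is
needed: this is the part of the direction `→` of `Knot.reidemeisterR` away from the finitely many
non-regular times of a generic isotopy. [cite: Reidemeister1932, Kap. I §1] -/
theorem rEquiv_diagram_along_of_isPreconnected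
    (hF : ∀ t (x : Metric.sphere (0 : EuclideanSpace ℝ (Fin 2)) 1), F.toFun t (K x) ≠ northPole)
    {S : Set ℝ} (hS : IsPreconnected S) (hreg : ∀ t ∈ S, Nonempty ((K.along F t).RegularProjection))
    {a b : ℝ} (ha : a ∈ S) (hb : b ∈ S) (Pa : (K.along F a).RegularProjection)
    (Pb : (K.along F b).RegularProjection) : Pa.diagram.REquiv Pb.diagram :=
  (equiv_diagram_along_of_isPreconnected K F hF hS hreg ha hb Pa Pb).rEquiv

variable (K) in
/-- Interval form, starting from the knot itself (`K.along F 0 = K`): if the knot never meets the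
pole along `F` and the moved knot is in regular position at every time of `[0, T]`, then a regular
projection of `K` and a regular projection of the moved knot `K.along F T` read Polyak-equivalent
(indeed relabelled) Gauss diagrams. [cite: Reidemeister1932, Kap. I §1] -/
theorem equiv_diagram_along_of_forall_mem_Icc
    (hF : ∀ t (x : Metric.sphere (0 : EuclideanSpace ℝ (Fin 2)) 1), F.toFun t (K x) ≠ northPole)
    {T : ℝ} (hT : 0 ≤ T) (hreg : ∀ t ∈ Icc 0 T, Nonempty ((K.along F t).RegularProjection))
    (P : K.RegularProjection) (PT : (K.along F T).RegularProjection) :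
    P.diagram.Equiv PT.diagram := by
  obtain ⟨P₀, hP₀⟩ := exists_diagram_eq_of_eq (K.along_zero F).symm P
  rw [← hP₀]
  exact equiv_diagram_along_of_isPreconnected K F hF isPreconnected_Icc hreg
    (left_mem_Icc.2 hT) (right_mem_Icc.2 hT) P₀ PT

end RegularProjection

end Knot

end Literature.Topology.FourManifolds
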